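import Literature.Analysis.FunctionSpaces.TorusPerturbedNSLocalExistence

/-!
# Short-time solutions of the perturbation system around a classical trajectory, uniform life span
# (line `ergodic-budget-selection-closing`, crux `BaireTransfer.DenseLoudDesignerForces`,
# stmt-AnomalousDissipation-1143) — tools stub E5 of block N-E

Sorry-free file over the landed existence theorem for the perturbed Navier–Stokes system on the flat torus
(`Literature/Analysis/FunctionSpaces/TorusPerturbedNSLocalExistence.lean`: `Torus.perturbedNS_exists_local`,
the Fourier–Picard construction `Literature/Analysis/FluidPDE/PerturbedNSFourier*` in the order-four
weighted sup-norm on the frequency lattice, whose life span depends on the datum only through a bound of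
its fourth Sobolev sums and on the background only through sup-in-time coefficient bounds on `[a, b]`).
Block N-E of the line runs a continuation argument for classical NS_ν(F) solutions: the body force is
absorbed by the background (`u + v` solves NS_ν(F) whenever `v` solves the perturbation system around a
solution `u`), so what is needed is a short-time solver for the PERTURBATION system with a step uniform
over the start time and over `H⁴`-bounded data; this file supplies exactly that:

* `stub_perturbedLocalExistenceTools` (the REGISTERED tools stub, proved) — for `ν > 0`, `a < b`, `u`
  jointly smooth on `[a, b] × T³` with divergence-free slices and every `M` there is `θ > 0` such that
  from every `t₀ ∈ [a, b]` with `t₀ + θ ≤ b` and every smooth divergence-free mean-zero `v₀` with fourth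
  Sobolev sums `≤ M` the system `∂ₜv + (v·∇)v + (u·∇)v + (v·∇)u = νΔv − ∇q`, `div v = 0`, `∫ v = 0`
  has a smooth solution on `[t₀, t₀ + θ]` with `v(t₀) = v₀` (the case `d = Fin 3` of
  `Torus.perturbedNS_exists_local`, dropping the mean-zero pressure clause).

References: A. J. Majda, A. L. Bertozzi, *Vorticity and Incompressible Flow* (CUP 2002), Thm. 3.4 (local
`H^m` theory, life span `T(‖v₀‖_{H^m})`); A. Cheskidov, X. Luo, *Sharp nonuniqueness for the Navier–Stokes
equations*, Invent. Math. 229 (2022), §3.1 (3.2), Prop. 3.2 (the perturbation system around a smooth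
background). Nothing is asserted; no definition is added.
-/

-- `Summit.<Summit>.<Problem>` is the tree's mandated summit-side namespace (CONVENTIONS §2); for this
-- single-conjunct summit the two coincide, so the duplicate is deliberate.
set_option linter.dupNamespace false

noncomputable section

open Set Function MeasureTheory Filter
open scoped InnerProductSpace

namespace Summit.AnomalousDissipation.AnomalousDissipation.Theorems.DenseLoudDesignerForces.Ergodic

open Literature.Analysis.FunctionSpaces Literature.Analysis.FunctionSpaces.Torus
open Literature.Analysis.FluidPDE Literature.Analysis.FluidPDE.Torus

/-- **Tools stub E5 — short-time smooth solutions of the PERTURBATION (Cheskidov–Luo corrector) system with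
nonzero datum, zero stress, general `ν > 0`, with a life span uniform over the start time and over data of
bounded fourth Sobolev sums.**  Along a smooth divergence-free background `u` on `[a, b] × T³` and for every
`M`, there is `θ = θ(ν, u, M) > 0` such that from every `t₀ ∈ [a, b]` with `t₀ + θ ≤ b` and every smooth
divergence-free mean-zero `v₀` with `∑_{k∈S}(1+|k|²)⁴‖v̂₀(k)‖² ≤ M` (all finite `S`) the system
`∂ₜv + (v·∇)v + (u·∇)v + (v·∇)u = νΔv − ∇q`, `div v = 0`, `∫ v = 0` has a smooth solution on
`[t₀, t₀ + θ]` with `v(t₀) = v₀` (Majda–Bertozzi 2002, Thm. 3.4: local `H^m` theory with life span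
`T(‖v₀‖_{H^m})`, `m > d/2 + 1`; Cheskidov–Luo 2022 §3.1 (3.2) / Prop. 3.2 for the perturbation system, there
with zero datum and stress forcing).  Proof: the tree's `Torus.perturbedNS_exists_local` (Fourier–Picard
construction in the order-four ball on the frequency lattice, `PerturbedNSFourier*`; the datum enters only
through `sup (1+‖k‖)⁴|v̂₀(k)| ≤ 4√M`, the background only through sup-in-time order-four coefficient bounds on
the compact `[a, b]`) at `d = Fin 3`. [cite: CheskidovLuo2022, §3.1 (3.2) and Prop. 3.2] -/
theorem stub_perturbedLocalExistenceTools {ν : ℝ} (hν : 0 < ν) {a b : ℝ} (hab : a < b)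
    {u : ℝ → (UnitAddTorus (Fin 3)) → (EuclideanSpace ℝ (Fin 3))} (hu : IsSmoothSpaceTimeOn (Icc a b) u)
    (hudiv : ∀ t ∈ Icc a b, IsDivFree (u t)) (M : ℝ) :
    ∃ θ : ℝ, 0 < θ ∧ ∀ t₀ ∈ Icc a b, t₀ + θ ≤ b →
      ∀ (v₀ : (UnitAddTorus (Fin 3)) → (EuclideanSpace ℝ (Fin 3))), IsSmooth v₀ → IsDivFree v₀ → HasZeroMean v₀ →
      (∀ S : Finset (Fin 3 → ℤ),
        ∑ k ∈ S, (1 + freqNormSq k) ^ 4 * ‖UnitAddTorus.mFourierCoeff (EuclideanSpace.complexify ∘ v₀) k‖ ^ 2 ≤ M) →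
      ∃ (v : ℝ → (UnitAddTorus (Fin 3)) → (EuclideanSpace ℝ (Fin 3))) (q : ℝ → (UnitAddTorus (Fin 3)) → ℝ),
        IsSmoothSpaceTimeOn (Icc t₀ (t₀ + θ)) v ∧ IsSmoothSpaceTimeOn (Icc t₀ (t₀ + θ)) q ∧
        (∀ t ∈ Icc t₀ (t₀ + θ), IsDivFree (v t)) ∧ (∀ t ∈ Icc t₀ (t₀ + θ), HasZeroMean (v t)) ∧
        (∀ t ∈ Icc t₀ (t₀ + θ), ∀ x, Torus.timeDerivWithin (Icc t₀ (t₀ + θ)) v t x + convect (v t) (v t) x +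
          convect (u t) (v t) x + convect (v t) (u t) x = ν • laplacian (v t) x - Torus.gradient (q t) x) ∧
        v t₀ = v₀ := by
  obtain ⟨θ, hθ, hsol⟩ :=
    Torus.perturbedNS_exists_local (d := Fin 3) (by rw [Fintype.card_fin]) hν hab hu hudiv M
  refine ⟨θ, hθ, fun t₀ ht₀ hθb v₀ hv₀ hv₀div hv₀mean hM => ?_⟩
  obtain ⟨v, q, h1, h2, h3, h4, -, h6, h7⟩ := hsol t₀ ht₀ hθb v₀ hv₀ hv₀div hv₀mean hM
  exact ⟨v, q, h1, h2, h3, h4, h6, h7⟩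

end Summit.AnomalousDissipation.AnomalousDissipation.Theorems.DenseLoudDesignerForces.Ergodic

end
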